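/-
Copyright: the b2b-balaban T⁴-continuum CRUX team, row NE7b OWNER lineage `t4-ne7b-p1` (gen 128). Project licence.
-/
import Summits.QuantumFields.BalabanUV.T4Continuum.Spine.NE7b.SupRegulatedActivityBound

/-!
# THE ROAD'S FLUCTUATION FACTORS ARE REGULATED: if the per-site remainders `w_x` are STABLE (`w_x(t) ≥ −κ₀t²`, `κ₀ ≥ 0`) and CUBICALLY
# SMALL on small fields (`|w_x(t)| ≤ c₃|t|³` for `|t| ≤ h`), then for every cell `p` of `≤ v` sites and every regulator strength `κ ≥ 2κ₀`
# the cell factor `g_p(ω) = e^{−Σ_{x∈p} w_x(ω_x)} − 1` obeys the REGULATED bound `|g_p(ω)| ≤ ε(h)·e^{½κΣ_{x∈p}ω_x²}` for ALL fields, with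
# `ε(h) = max(e^{c₃vh³} − 1, 2e^{−(κ∕2−κ₀)h²})` (small fields by the cubic Taylor size, large fields paid by the regulator) — so (289) applies:
# over a finite-range Gaussian field `N(0,Γ)` with `Γ ⪯ γ_op·1`, `κγ_op ≤ θ < 1`, the road-shaped perturbation `∫∏_p(1+g_p)dN(0,Γ)` is a
# zero-free polymer gas with `‖log Z(C)‖ ≤ #C(Δ+1)2e·ε(h)A^v`, uniformly in the volume (row NE7b, node U5c; (289) BY NAME + real analysis;
# [folklore])

Cell `pub-balaban`, sub-cell `t4`, spine estimate NE7b (`T4WeightBudget.RelWeightBound`; the cell's OWN estimate — NOT PRINTED in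
[Bałaban 1983–89], NOT PROVED).  Crux-route work under `Spine/NE7b/` by the row OWNER (`t4-ne7b-p1` gen 128, file (290)) under FREEZE
(0)'s crux-prover clause, on § [NE7bP1-G127-HANDOFF] NEXT (3)(b); NOTHING of Bałaban's is named as a Lean object, valued or asserted; no
`T4Continuum/Support` leaf typed; no `def`, no notation; zero `sorry`.  Imports (BY NAME): the OWNER's (289) `…SupRegulatedActivityBound`
(`regulated_pertZ_eq_polymerPartitionFunction`, `regulated_pertZ_ne_zero`, `regulated_norm_pertLogZ_le`) and through it (287)∕(288)∕(276);
Mathlib's `Real.add_one_le_exp`, `Real.exp_le_exp`, `Finset.single_le_sum`, `Finset.abs_sum_le_sum_abs`.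

WHY (located).  The road's fluctuation integrand after extracting the background and the Hessian is `e^{−Σ_x w_x(ζ_x)}` with `w_x` the
third-order Taylor remainder of the single-site potential at the background (`|w_x(t)| ≤ (sup|u‴|∕6)|t|³`) which is STABLE
(`w_x(t) ≥ −½(λ + u″(φ_x))t² ≥ −½(λ+Λ)t²` on the class `−λ ≤ u″ ≤ Λ`); the cell factors `e^{−Σ_{x∈p}w_x} − 1` are therefore NOT sup-small
but ARE regulated-small — which is exactly (289)'s input.  The honest price is visible in the constants: `κ ≥ λ + Λ` (the regulator must
dominate the stability loss) together with (289)'s `κγ_op ≤ θ < 1` forces `(λ+Λ)·γ_op < 1` — the stability loss per site must be smaller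
than the inverse size of the fluctuation covariance — and `ε(h)` is small only when `c₃vh³ ≪ 1 ≪ (κ∕2−κ₀)h²`, i.e. for WEAK anharmonicity
`c₃ ≪ (κ∕2−κ₀)^{3∕2}∕v` (small coupling).

WHAT IS PROVED ([folklore]):
* §1 real analysis: `abs_exp_sub_one_le` (`|e^t − 1| ≤ e^{|t|} − 1`), `abs_sub_one_le_add_one` (`y > 0 ⟹ |y − 1| ≤ y + 1`),
  `sq_le_sum_sq` (`ζ_x² ≤ Σ_{y∈p}ζ_y²`);
* §2 **`road_factor_regulated`** (stability + cubic smallness + `#p ≤ v`, `0 ≤ κ₀`, `2κ₀ ≤ κ`, `0 ≤ c₃`, `0 ≤ h` ⟹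
  `|e^{−Σ_{x∈p}w_x(ζ_x)} − 1| ≤ max(e^{c₃vh³} − 1, 2e^{−(κ∕2−κ₀)h²})·e^{½κΣ_{x∈p}ζ_x²}` for EVERY `ζ`), `road_eps_nonneg`,
  `road_factor_norm_le` (the same for the complexified factor, in (289)'s `hreg` format);
* §3 `road_factor_measurable` (the factor of cell `p` is measurable for `σ(ω|_{cell p})` when every `w_x` is measurable);
* §4 THE END, for road-shaped factors over `N(0,Γ)` (`Γ ⪰ 0` of range `ρ`, `Γ ⪯ γ_op·1`, diagonal `≤ γ`, disjoint cells of `≤ v` sites with an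
  adjacency covering `ρ`-closeness and `≤ Δ` neighbours, `0 ≤ κ₀`, `2κ₀ ≤ κ`, `κγ_op ≤ θ < 1`): **`road_pertZ_eq_polymerPartitionFunction`**,
  **`road_pertZ_ne_zero`** and **`road_norm_pertLogZ_le`** (`‖log Z(C)‖ ≤ #C(Δ+1)2e·ε(h)A^v`) under `e·ε(h)A^v·(Δ+1)² ≤ 1∕2`; §5 toy.

HONEST (what this is NOT).  The stability and cubic bounds of the per-site remainders are INPUTS (for the road they are the Taylor facts of
the single-site potential on the class `−λ ≤ u″ ≤ Λ`, `|u‴| ≤ 6c₃`, typed elsewhere in the column, not re-derived here); one finite-range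
Gaussian reference (one scale); the activities' dependence on the next field, the multiscale induction and Bałaban's large-field REGIONS are
not typed; scalar skeleton ((A3), NC-NE7b-α UNRULED); nothing of Bałaban's asserted.  BY-NAME EFFECT ON THE WALL: NONE.  NE7b NOT PRINTED ∕ NOT
PROVED; spine PROVED 0∕9; rung (B)+1 — the programme's measures remain FINITE-torus statements; NOT the mass gap, NOT Clay.  HONEST DEPENDENCY:
continuum YM on T⁴ ⇐ BetaPertH ∧ nine spine estimates (0∕9 proved); BetaPertH ⇐ (D1) ∧ (D4) ∧ CAP+tail; G-an2-4 gates asym, D1 and NE2∕3∕4.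
-/

set_option autoImplicit false

noncomputable section

namespace Summit.QuantumFields.BalabanUV.T4Continuum.NE7b.SupRoadFactorRegulated

open MeasureTheory ProbabilityTheory Finset Real
open scoped BigOperators
open Literature.Probability.LatticeModels (Touches GeomInc IsRConnected pertZ cellActivity pertLogZ rconnSubsets
  polymerPartitionFunction)
open Literature.Analysis.Matrix (HasFiniteRange)
open SupRegulatedActivityBound

variable {ι : Type} [Fintype ι] [DecidableEq ι] {V : Type*}

/-! ## §1. Real analysis -/

/-- `|e^t − 1| ≤ e^{|t|} − 1` for every real `t` (for `t < 0`: `1 − e^t ≤ e^{−t} − 1 ⟺ 2 ≤ e^t + e^{−t}`). [folklore] -/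
theorem abs_exp_sub_one_le (t : ℝ) : |exp t - 1| ≤ exp |t| - 1 := by
  rcases le_or_gt 0 t with ht | ht
  · rw [abs_of_nonneg ht, abs_of_nonneg (by linarith [one_le_exp_iff.2 ht] : (0 : ℝ) ≤ exp t - 1)]
  · rw [abs_of_neg ht]
    have h1 : exp t ≤ 1 := exp_le_one_iff.2 ht.le
    rw [abs_of_nonpos (by linarith : exp t - 1 ≤ 0)]
    have h2 : t + 1 ≤ exp t := add_one_le_exp t
    have h3 : -t + 1 ≤ exp (-t) := add_one_le_exp (-t)
    linarith

/-- `y > 0 ⟹ |y − 1| ≤ y + 1`. [folklore] -/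
theorem abs_sub_one_le_add_one {y : ℝ} (hy : 0 < y) : |y - 1| ≤ y + 1 := by
  rw [abs_le]
  constructor <;> linarith

omit [Fintype ι] [DecidableEq ι] in
/-- One square is at most the sum of squares: `x ∈ p ⟹ ζ_x² ≤ Σ_{y∈p} ζ_y²`. [folklore] -/
theorem sq_le_sum_sq (P : Finset ι) (ζ : ι → ℝ) {x : ι} (hx : x ∈ P) : ζ x ^ 2 ≤ ∑ y ∈ P, ζ y ^ 2 :=
  single_le_sum (f := fun y => ζ y ^ 2) (fun y _ => sq_nonneg (ζ y)) hx

/-! ## §2. The regulated bound for one cell factor -/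

omit [Fintype ι] [DecidableEq ι] in
/-- **THE ROAD'S CELL FACTOR IS REGULATED.**  Per-site remainders `w_x` on the cell `p` (`#p ≤ v`) with STABILITY `w_x(t) ≥ −κ₀t²`
(`κ₀ ≥ 0`) and CUBIC SMALLNESS `|w_x(t)| ≤ c₃|t|³` for `|t| ≤ h` (`c₃, h ≥ 0`); regulator strength `κ ≥ 2κ₀` ⟹ for EVERY field `ζ`:
`|e^{−Σ_{x∈p} w_x(ζ_x)} − 1| ≤ max(e^{c₃vh³} − 1, 2e^{−(κ∕2−κ₀)h²}) · e^{½κΣ_{x∈p} ζ_x²}`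
(small fields: `|W| ≤ c₃vh³` and `|e^{−W}−1| ≤ e^{|W|}−1`; large fields: `Σζ² ≥ h²`, `e^{−W} ≤ e^{κ₀Σζ²} = e^{−(κ∕2−κ₀)Σζ²}e^{½κΣζ²}`). [folklore] -/
theorem road_factor_regulated (P : Finset ι) {v : ℕ} (hv : P.card ≤ v) (w : ι → ℝ → ℝ) {κ₀ c₃ h κ : ℝ} (hκ₀ : 0 ≤ κ₀)
    (hc₃ : 0 ≤ c₃) (hh : 0 ≤ h) (hstab : ∀ x ∈ P, ∀ t : ℝ, -(κ₀ * t ^ 2) ≤ w x t)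
    (hcub : ∀ x ∈ P, ∀ t : ℝ, |t| ≤ h → |w x t| ≤ c₃ * |t| ^ 3) (hκ : 2 * κ₀ ≤ κ) (ζ : ι → ℝ) :
    |exp (-(∑ x ∈ P, w x (ζ x))) - 1| ≤
      max (exp (c₃ * v * h ^ 3) - 1) (2 * exp (-((κ / 2 - κ₀) * h ^ 2))) * exp (κ * (∑ x ∈ P, ζ x ^ 2) / 2) := by
  set S : ℝ := ∑ x ∈ P, ζ x ^ 2 with hS
  set W : ℝ := ∑ x ∈ P, w x (ζ x) with hW
  set ε : ℝ := max (exp (c₃ * v * h ^ 3) - 1) (2 * exp (-((κ / 2 - κ₀) * h ^ 2))) with hε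
  have hS0 : 0 ≤ S := sum_nonneg fun x _ => sq_nonneg (ζ x)
  have hκ0 : 0 ≤ κ := by linarith
  have hreg1 : 1 ≤ exp (κ * S / 2) := one_le_exp_iff.2 (by positivity)
  have hε0 : 0 ≤ ε := le_trans (by positivity) (le_max_right _ _)
  by_cases hsm : ∀ x ∈ P, |ζ x| ≤ h
  · -- small fields on the whole cell
    have hWabs : |W| ≤ c₃ * v * h ^ 3 := by
      calc |W| ≤ ∑ x ∈ P, |w x (ζ x)| := abs_sum_le_sum_abs _ _
        _ ≤ ∑ x ∈ P, c₃ * |ζ x| ^ 3 := sum_le_sum fun x hx => hcub x hx (ζ x) (hsm x hx)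
        _ ≤ ∑ _x ∈ P, c₃ * h ^ 3 := sum_le_sum fun x hx =>
            mul_le_mul_of_nonneg_left (pow_le_pow_left₀ (abs_nonneg _) (hsm x hx) 3) hc₃
        _ = P.card * (c₃ * h ^ 3) := by rw [sum_const, nsmul_eq_mul]
        _ ≤ v * (c₃ * h ^ 3) := mul_le_mul_of_nonneg_right (by exact_mod_cast hv) (by positivity)
        _ = c₃ * v * h ^ 3 := by ring
    calc |exp (-W) - 1| ≤ exp |-W| - 1 := abs_exp_sub_one_le (-W)
      _ ≤ exp (c₃ * v * h ^ 3) - 1 := by rw [abs_neg]; linarith [exp_le_exp.2 hWabs]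
      _ ≤ ε := le_max_left _ _
      _ ≤ ε * exp (κ * S / 2) := le_mul_of_one_le_right hε0 hreg1
  · -- a large field somewhere in the cell
    push Not at hsm
    obtain ⟨x, hxP, hxh⟩ := hsm
    have hhS : h ^ 2 ≤ S := by
      have h1 : h ^ 2 ≤ ζ x ^ 2 := by
        rw [← sq_abs (ζ x)]
        exact pow_le_pow_left₀ hh hxh.le 2
      exact h1.trans (sq_le_sum_sq P ζ hxP)
    have hWS : -W ≤ κ₀ * S := by
      rw [hW, hS, mul_sum, ← sum_neg_distrib]
      exact sum_le_sum fun y hy => by linarith [hstab y hy (ζ y)]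
    have hmargin : (κ / 2 - κ₀) * h ^ 2 ≤ (κ / 2 - κ₀) * S := mul_le_mul_of_nonneg_left hhS (by linarith)
    calc |exp (-W) - 1| ≤ exp (-W) + 1 := abs_sub_one_le_add_one (exp_pos _)
      _ ≤ 2 * exp (κ₀ * S) := by
          have h1 : exp (-W) ≤ exp (κ₀ * S) := exp_le_exp.2 hWS
          have h2 : 1 ≤ exp (κ₀ * S) := one_le_exp_iff.2 (by positivity)
          linarith
      _ = 2 * exp (-((κ / 2 - κ₀) * S)) * exp (κ * S / 2) := by
          rw [mul_assoc, ← exp_add]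
          congr 2
          ring
      _ ≤ 2 * exp (-((κ / 2 - κ₀) * h ^ 2)) * exp (κ * S / 2) := by
          refine mul_le_mul_of_nonneg_right ?_ (exp_pos _).le
          exact mul_le_mul_of_nonneg_left (exp_le_exp.2 (neg_le_neg hmargin)) zero_le_two
      _ ≤ ε * exp (κ * S / 2) := mul_le_mul_of_nonneg_right (le_max_right _ _) (exp_pos _).le

/-- The road's smallness parameter `ε(h) = max(e^{c₃vh³} − 1, 2e^{−(κ∕2−κ₀)h²})` is `≥ 0`. [folklore] -/
theorem road_eps_nonneg (c₃ : ℝ) (v : ℕ) (h κ κ₀ : ℝ) :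
    0 ≤ max (exp (c₃ * v * h ^ 3) - 1) (2 * exp (-((κ / 2 - κ₀) * h ^ 2))) :=
  le_trans (by positivity) (le_max_right _ _)

omit [Fintype ι] [DecidableEq ι] in
/-- **The regulated bound in (289)'s format**: for cells `cell p` of `≤ v` sites with stable, cubically small remainders, the complexified
road factor `g_p(ω) = e^{−Σ_{x∈cell p}w_x(ω_x)} − 1` obeys `‖g_p(ω)‖ ≤ ε(h)·e^{½κΣ_{x∈cell p}ω_x²}` for every `p` and `ω`. [folklore] -/
theorem road_factor_norm_le (cell : V → Finset ι) {v : ℕ} (hv : ∀ p, (cell p).card ≤ v) (w : ι → ℝ → ℝ) {κ₀ c₃ h κ : ℝ}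
    (hκ₀ : 0 ≤ κ₀) (hc₃ : 0 ≤ c₃) (hh : 0 ≤ h) (hstab : ∀ x, ∀ t : ℝ, -(κ₀ * t ^ 2) ≤ w x t)
    (hcub : ∀ x, ∀ t : ℝ, |t| ≤ h → |w x t| ≤ c₃ * |t| ^ 3) (hκ : 2 * κ₀ ≤ κ) (p : V) (ω : EuclideanSpace ℝ ι) :
    ‖(((exp (-(∑ x ∈ cell p, w x (ω x))) - 1 : ℝ)) : ℂ)‖ ≤
      max (exp (c₃ * v * h ^ 3) - 1) (2 * exp (-((κ / 2 - κ₀) * h ^ 2))) * exp (κ * (∑ x ∈ cell p, ω x ^ 2) / 2) := by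
  rw [Complex.norm_real, Real.norm_eq_abs]
  exact road_factor_regulated (cell p) (hv p) w hκ₀ hc₃ hh (fun x _ t => hstab x t) (fun x _ t ht => hcub x t ht) hκ
    (fun x => ω x)

/-! ## §3. Measurability of the road's cell factors for the cell σ-algebras -/

omit [Fintype ι] [DecidableEq ι] in
/-- **The road factor of cell `p` is `σ(ω|_{cell p})`-measurable** when every `w_x` is measurable (it is a measurable function of the
restriction `ω|_{cell p}`). [folklore] -/
theorem road_factor_measurable (cell : V → Finset ι) (w : ι → ℝ → ℝ) (hw : ∀ x, Measurable (w x)) (p : V) :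
    Measurable[MeasurableSpace.comap (fun (ω : EuclideanSpace ℝ ι) (x : cell p) => ω x) inferInstance]
      (fun ω : EuclideanSpace ℝ ι => (((exp (-(∑ x ∈ cell p, w x (ω x))) - 1 : ℝ)) : ℂ)) := by
  -- the factor is `G ∘ restrict` with `G : (cell p → ℝ) → ℂ` measurable
  set G : (cell p → ℝ) → ℂ := fun f => (((exp (-(∑ x : cell p, w x (f x))) - 1 : ℝ)) : ℂ) with hG
  have hGm : Measurable G := by
    refine Complex.measurable_ofReal.comp ((measurable_exp.comp (Finset.measurable_sum _ fun x _ => ?_).neg).sub_const 1)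
    exact (hw x).comp (measurable_pi_apply x)
  have hfun : (fun ω : EuclideanSpace ℝ ι => (((exp (-(∑ x ∈ cell p, w x (ω x))) - 1 : ℝ)) : ℂ)) =
      G ∘ (fun (ω : EuclideanSpace ℝ ι) (x : cell p) => ω x) := by
    funext ω
    simp only [hG, Function.comp_apply]
    rw [← Finset.sum_coe_sort (cell p) (fun x => w x (ω x))]
  rw [hfun]
  exact hGm.comp (Measurable.of_comap_le le_rfl)

/-! ## §4. THE END: the road-shaped perturbation of a finite-range Gaussian field is a convergent polymer gas -/

/-- **THE POLYMER REPRESENTATION for road-shaped factors** `g_p = e^{−Σ_{x∈cell p}w_x} − 1` over `N(0,Γ)` (`Γ ⪰ 0` of range `ρ`,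
`Γ ⪯ γ_op·1`, diagonal `≤ γ`; disjoint cells of `≤ v` sites; adjacency covering `ρ`-closeness; stable, cubically small, measurable
remainders; `0 ≤ κ₀`, `2κ₀ ≤ κ`, `κγ_op ≤ θ < 1`): `Z(C) = Ξ(𝒫(C); M)`. [folklore] -/
theorem road_pertZ_eq_polymerPartitionFunction [DecidableEq V] {Γ : Matrix ι ι ℝ} {γop γ : ℝ} (hΓ : Γ.PosSemidef)
    (hΓop : (γop • (1 : Matrix ι ι ℝ) - Γ).PosSemidef) (hdiag : ∀ i, Γ i i ≤ γ) (hγ : 0 ≤ γ) {dι : ι → ι → ℕ} {ρ : ℕ}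
    (hfr : HasFiniteRange dι ρ Γ) (cell : V → Finset ι) (hdisj : ∀ p q, p ≠ q → Disjoint (cell p) (cell q)) {v : ℕ}
    (hv : ∀ p, (cell p).card ≤ v) {R : V → V → Prop} [DecidableRel R] (hRsymm : ∀ x y, R x y → R y x)
    (hR : ∀ (p p' : V) (x y : ι), x ∈ cell p → y ∈ cell p' → dι x y ≤ ρ → p = p' ∨ R p p')
    (w : ι → ℝ → ℝ) (hw : ∀ x, Measurable (w x)) {κ₀ c₃ h κ θ : ℝ} (hκ₀ : 0 ≤ κ₀) (hc₃ : 0 ≤ c₃) (hh : 0 ≤ h)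
    (hstab : ∀ x, ∀ t : ℝ, -(κ₀ * t ^ 2) ≤ w x t) (hcub : ∀ x, ∀ t : ℝ, |t| ≤ h → |w x t| ≤ c₃ * |t| ^ 3) (hκ : 2 * κ₀ ≤ κ)
    (hθ0 : 0 < θ) (hθ1 : θ < 1) (hκθ : κ * γop ≤ θ) (C : Finset V) :
    pertZ (multivariateGaussian 0 Γ) (fun p ω => (((exp (-(∑ x ∈ cell p, w x (ω x))) - 1 : ℝ)) : ℂ)) C =
      polymerPartitionFunction (GeomInc R)
        (cellActivity (multivariateGaussian 0 Γ) (fun p ω => (((exp (-(∑ x ∈ cell p, w x (ω x))) - 1 : ℝ)) : ℂ)))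
        (rconnSubsets R C) :=
  regulated_pertZ_eq_polymerPartitionFunction hΓ hΓop hdiag hγ hfr cell hdisj hv hRsymm hR (road_eps_nonneg c₃ v h κ κ₀)
    (by linarith) hθ0 hθ1 hκθ (road_factor_measurable cell w hw) (road_factor_norm_le cell hv w hκ₀ hc₃ hh hstab hcub hκ) C

/-- **ZERO-FREENESS for road-shaped factors** under `e·ε(h)A^v·(Δ+1)² ≤ 1∕2`, `A = (1−θ)^{−κγ∕(2θ)}`. [folklore] -/
theorem road_pertZ_ne_zero [DecidableEq V] {Γ : Matrix ι ι ℝ} {γop γ : ℝ} (hΓ : Γ.PosSemidef)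
    (hΓop : (γop • (1 : Matrix ι ι ℝ) - Γ).PosSemidef) (hdiag : ∀ i, Γ i i ≤ γ) (hγ : 0 ≤ γ) {dι : ι → ι → ℕ} {ρ : ℕ}
    (hfr : HasFiniteRange dι ρ Γ) (cell : V → Finset ι) (hdisj : ∀ p q, p ≠ q → Disjoint (cell p) (cell q)) {v : ℕ}
    (hv : ∀ p, (cell p).card ≤ v) {R : V → V → Prop} [DecidableRel R] (hRsymm : ∀ x y, R x y → R y x)
    (hR : ∀ (p p' : V) (x y : ι), x ∈ cell p → y ∈ cell p' → dι x y ≤ ρ → p = p' ∨ R p p') {nbr : V → Finset V} {Δ : ℕ}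
    (hΔ : ∀ x, (nbr x).card ≤ Δ) (hnbr : ∀ x y, R x y → y ∈ nbr x)
    (w : ι → ℝ → ℝ) (hw : ∀ x, Measurable (w x)) {κ₀ c₃ h κ θ : ℝ} (hκ₀ : 0 ≤ κ₀) (hc₃ : 0 ≤ c₃) (hh : 0 ≤ h)
    (hstab : ∀ x, ∀ t : ℝ, -(κ₀ * t ^ 2) ≤ w x t) (hcub : ∀ x, ∀ t : ℝ, |t| ≤ h → |w x t| ≤ c₃ * |t| ^ 3) (hκ : 2 * κ₀ ≤ κ)
    (hθ0 : 0 < θ) (hθ1 : θ < 1) (hκθ : κ * γop ≤ θ)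
    (hsmall : Real.exp 1 * (max (exp (c₃ * v * h ^ 3) - 1) (2 * exp (-((κ / 2 - κ₀) * h ^ 2))) *
      ((1 - θ) ^ (-(κ * γ / (2 * θ)))) ^ v) * ((Δ : ℝ) + 1) ^ 2 ≤ 1 / 2) (C : Finset V) :
    pertZ (multivariateGaussian 0 Γ) (fun p ω => (((exp (-(∑ x ∈ cell p, w x (ω x))) - 1 : ℝ)) : ℂ)) C ≠ 0 :=
  regulated_pertZ_ne_zero hΓ hΓop hdiag hγ hfr cell hdisj hv hRsymm hR hΔ hnbr (road_eps_nonneg c₃ v h κ κ₀) (by linarith)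
    hθ0 hθ1 hκθ (road_factor_measurable cell w hw) (road_factor_norm_le cell hv w hκ₀ hc₃ hh hstab hcub hκ) hsmall C

/-- **THE END — `log Z` OF THE ROAD-SHAPED PERTURBATION IS EXTENSIVE, UNIFORMLY IN THE VOLUME.**  `Γ ⪰ 0`, `Γ ⪯ γ_op·1`, diagonal `≤ γ`
(`γ ≥ 0`); disjoint cells of `≤ v` sites; `R` symmetric with `≤ Δ` neighbours; stable (`κ₀ ≥ 0`), cubically small (`c₃, h ≥ 0`) remainders;
`2κ₀ ≤ κ`, `0 < θ < 1`, `κγ_op ≤ θ`; `e·ε(h)A^v·(Δ+1)² ≤ 1∕2` ⟹ `‖log Z(C)‖ ≤ #C·(Δ+1)·2e·ε(h)A^v` for every finite cell set `C`,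
`ε(h) = max(e^{c₃vh³} − 1, 2e^{−(κ∕2−κ₀)h²})`, `A = (1−θ)^{−κγ∕(2θ)}`. [folklore] -/
theorem road_norm_pertLogZ_le [DecidableEq V] {Γ : Matrix ι ι ℝ} {γop γ : ℝ} (hΓ : Γ.PosSemidef)
    (hΓop : (γop • (1 : Matrix ι ι ℝ) - Γ).PosSemidef) (hdiag : ∀ i, Γ i i ≤ γ) (hγ : 0 ≤ γ) (cell : V → Finset ι)
    (hdisj : ∀ p q, p ≠ q → Disjoint (cell p) (cell q)) {v : ℕ} (hv : ∀ p, (cell p).card ≤ v) {R : V → V → Prop} [DecidableRel R]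
    (hRsymm : ∀ x y, R x y → R y x) {nbr : V → Finset V} {Δ : ℕ} (hΔ : ∀ x, (nbr x).card ≤ Δ) (hnbr : ∀ x y, R x y → y ∈ nbr x)
    (w : ι → ℝ → ℝ) {κ₀ c₃ h κ θ : ℝ} (hκ₀ : 0 ≤ κ₀) (hc₃ : 0 ≤ c₃) (hh : 0 ≤ h)
    (hstab : ∀ x, ∀ t : ℝ, -(κ₀ * t ^ 2) ≤ w x t) (hcub : ∀ x, ∀ t : ℝ, |t| ≤ h → |w x t| ≤ c₃ * |t| ^ 3) (hκ : 2 * κ₀ ≤ κ)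
    (hθ0 : 0 < θ) (hθ1 : θ < 1) (hκθ : κ * γop ≤ θ)
    (hsmall : Real.exp 1 * (max (exp (c₃ * v * h ^ 3) - 1) (2 * exp (-((κ / 2 - κ₀) * h ^ 2))) *
      ((1 - θ) ^ (-(κ * γ / (2 * θ)))) ^ v) * ((Δ : ℝ) + 1) ^ 2 ≤ 1 / 2) (C : Finset V) :
    ‖pertLogZ (multivariateGaussian 0 Γ) (fun p ω => (((exp (-(∑ x ∈ cell p, w x (ω x))) - 1 : ℝ)) : ℂ)) R C‖ ≤
      C.card * ((Δ : ℝ) + 1) * (2 * (Real.exp 1 * (max (exp (c₃ * v * h ^ 3) - 1) (2 * exp (-((κ / 2 - κ₀) * h ^ 2))) *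
        ((1 - θ) ^ (-(κ * γ / (2 * θ)))) ^ v))) :=
  regulated_norm_pertLogZ_le hΓ hΓop hdiag hγ cell hdisj hv hRsymm hΔ hnbr (road_eps_nonneg c₃ v h κ κ₀) (by linarith) hθ0 hθ1 hκθ
    (road_factor_norm_le cell hv w hκ₀ hc₃ hh hstab hcub hκ) hsmall C

/-! ## §5. Toy -/

/-- Toy (§2 with the ZERO remainder on a one-site cell): `|e^0 − 1| = 0 ≤ ε(h)·e^{½κζ²}`. -/
example (ζ : Fin 1 → ℝ) :
    |exp (-(∑ x ∈ (Finset.univ : Finset (Fin 1)), (fun (_ : Fin 1) (_ : ℝ) => (0 : ℝ)) x (ζ x))) - 1| ≤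
      max (exp ((1 : ℝ) * (1 : ℕ) * (1 : ℝ) ^ 3) - 1) (2 * exp (-(((2 : ℝ) / 2 - 1) * (1 : ℝ) ^ 2))) *
        exp ((2 : ℝ) * (∑ x ∈ (Finset.univ : Finset (Fin 1)), ζ x ^ 2) / 2) :=
  road_factor_regulated (κ₀ := 1) (c₃ := 1) (h := 1) (κ := 2) (v := 1) Finset.univ (by simp)
    (fun (_ : Fin 1) (_ : ℝ) => (0 : ℝ)) (by norm_num) (by norm_num) (by norm_num)
    (fun x _ t => show -(1 * t ^ 2) ≤ (0 : ℝ) by nlinarith [sq_nonneg t])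
    (fun x _ t _ => show |(0 : ℝ)| ≤ 1 * |t| ^ 3 by rw [abs_zero]; positivity) (by norm_num) ζ

end Summit.QuantumFields.BalabanUV.T4Continuum.NE7b.SupRoadFactorRegulated
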